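import Summits.NavierStokesRegularity.FluidComputer.PalasekTowerRegisterGlobalEnvelopeAt
import Summits.NavierStokesRegularity.FluidComputer.PalasekTowerRegisterGlobalApriori
import Summits.NavierStokesRegularity.FluidComputer.PalasekTowerRescaledCopy

/-!
# REGISTER v2.3′: at the generic levels `k ≥ 2` the local-continuation stub is a theorem —
# `LocalContinuationAt k` holds, so `ContinuationEnvelopeAt k ↔ AprioriCeilingAt k`; the stub is open ONLY at `k ≤ 1`

Cell `ns-blowup`, seat `ns-blowup-ecbridge-7` (literature-prover; D-0074 GROUP C «BRIDGE SUPPORT»;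
bears_on LADDER-NS N1, route `PalasekTowerBreakdown`, child crux item stmt-NavierStokesRegularity-19249
`HeredityAtOne` — supported, NOT closed or claimed). Companion of
`PalasekTowerRegisterGlobalEnvelopeAt.lean` (this seat: `LocalContinuationAt k`, `AprioriCeilingAt k`,
`ContinuationEnvelopeAt k ↔ LocalContinuationAt k ∧ AprioriCeilingAt k` for `k ≥ 1`) and of
`PalasekTowerRegisterGlobalApriori.lean` (ecbridge-5 g2, p422740: `exists_isGlobalLerayHopf_extension_Icc`,
`Stage.exists_continuation_of_rep`). LABEL: E–C typing (KERNEL theorems; no `Prop` introduced, no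
named fact). WHAT THIS IS NOT: not Navier–Stokes evidence — no stage, flow or tower is constructed
or claimed.

* `Stage.exists_local_continuation (hν) (hQ) (hk : 2 ≤ k)` — every stage at a level `k ≥ 2` of a
  quiet schedule (any rates, margins, `ν > 0`) continues classically, with finite energy, under the
  design force, strictly past `τ k`: the stage translated to the origin `τ 1` is an UNFORCED
  finite-energy classical solution on `[0, τ k - τ 1]` — POSITIVE length — hence Leray–Hopf
  (`isLerayHopfOn_of_finiteEnergy`, Tao 2013 Lemma 8.1), part of a global Leray–Hopf field
  (`exists_isGlobalLerayHopf_extension_Icc`), and a BOUNDED classical representative of it (stage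
  ceiling `c₂ Y_k`), which continues strictly past its end (`exists_classical_extension_of_bounded_rep`,
  RRS 2016 Thm. 8.17) and glues back onto the stage (`Stage.exists_continuation_of_rep`).
* `localContinuationAt_of_two_le : 2 ≤ k → LocalContinuationAt k`, and
  `continuationEnvelopeAt_iff_aprioriCeilingAt_of_two_le : 2 ≤ k → (ContinuationEnvelopeAt k ↔ AprioriCeilingAt k)`
  (the level-wise form of ecbridge-5 g2's `continuationEnvelope_of_apriori` /
  `apriori_of_continuationEnvelope`). At `k = 1` the translated slab has length `0`: the local stub
  `LocalContinuationAt 1` («the level-1 flow crosses the end of the forced era») is the one piece of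
  the first rung's upper half NOT reduced to the a-priori ceiling by the tree.

* `localContinuationAt_iff_velocity`, `aprioriCeilingAt_iff_velocity` — both stubs may be stated with
  VELOCITY-only agreement on `[0, τ k]` (any pressure gauge; `exists_pressure_eq_on_Icc` re-gauges).
* `continuationEnvelopeAt_iff_runs`, `readoutFloorsAt_iff_runs_letter`, `heredityAtOne_iff_runs_and_letter` —
  the level-wise halves in the fc-oneshot line's vocabulary `Runs` / `Letter` (`PalasekTowerRescaledCopy.lean`):
  the line's `FirstGate` (= item 19249) splits into «∃ a continuation that RUNS» and «every RUN carries the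
  level-2 LETTER», losslessly.

References: J. C. Robinson, J. L. Rodrigo, W. Sadowski, *The Three-Dimensional Navier–Stokes
Equations*, CUP 2016, Thm. 8.17 [cite: RobinsonRodrigoSadowski2016, Thm. 8.17]; T. Tao, Anal. PDE 6
(2013), Lemma 8.1 [cite: Tao2011, Lemma 8.1]; J. Leray, Acta Math. 63 (1934) §33 [cite: Leray1934, §33];
C. R. Doering, J. D. Gibbon, *Applied Analysis of the Navier–Stokes Equations*, CUP 1995, §1.2
[cite: DoeringGibbon1995, §1.2]; S. Palasek, arXiv:2605.13827 §4 [cite: Palasek2026ElementaryModel, §4].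
-/

noncomputable section

namespace Summit.NavierStokesRegularity.FluidComputer.PalasekTowerClayBridge

open Set MeasureTheory Filter Topology Function Real
open scoped ENNReal ContDiff NNReal
open Literature.Analysis.FluidPDE
open Summit.NavierStokesRegularity.NavierStokesRegularity

/-! ## At the generic levels the local stub is a theorem -/

namespace Stage

variable {ν : ℝ} {R : TowerRates} {S : Schedule R} {m : Margins R} {k : ℕ}

/-- **At levels `k ≥ 2` every stage of a quiet schedule continues a little past `τ k` — no
hypothesis** (any rates, margins, `ν > 0`). The stage translated to the origin `τ 1` is an UNFORCED
finite-energy classical solution on `[0, τ k - τ 1]`, a slab of POSITIVE length, hence Leray–Hopf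
(Tao 2013 Lemma 8.1, `isLerayHopfOn_of_finiteEnergy`) and part of a global Leray–Hopf field
(`exists_isGlobalLerayHopf_extension_Icc`); it is a BOUNDED classical representative of that field
(stage ceiling `c₂ Y_k`), so it continues classically strictly past `τ k - τ 1`
(`exists_classical_extension_of_bounded_rep`, RRS 2016 Thm. 8.17), and the continuation glues back
onto the stage (ecbridge-5 g2's `Stage.exists_continuation_of_rep`). At `k = 1` the translated slab
has length `0` and this argument is void — `LocalContinuationAt 1` stays a stub.
[cite: RobinsonRodrigoSadowski2016, Thm. 8.17] -/
theorem exists_local_continuation (hν : 0 < ν) (hQ : S.Quiet) (hk : 2 ≤ k) (s : Stage ν R S m k) :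
    ∃ T' : ℝ, S.τ k < T' ∧
      ∃ (u : ℝ → EuclideanSpace ℝ (Fin 3) → EuclideanSpace ℝ (Fin 3))
        (p : ℝ → EuclideanSpace ℝ (Fin 3) → ℝ),
        IsClassicalNSSolutionOn (Icc 0 T') ν S.f u p ∧
        (∀ t ∈ Icc 0 (S.τ k), u t = s.u t ∧ p t = s.p t) ∧
        (∃ C : ℝ≥0∞, C < ⊤ ∧ ∀ t ∈ Icc 0 T', ∫⁻ x, ‖u t x‖ₑ ^ 2 ≤ C) := by
  have h1k : S.τ 1 < S.τ k := S.τ_strictMono (by omega : 1 < k)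
  set τ₁ : ℝ := S.τ 1 with hτ₁
  set τk : ℝ := S.τ k with hτk
  set L : ℝ := τk - τ₁ with hL
  have hL0 : 0 < L := by rw [hL]; linarith
  have hτ₁0 : 0 ≤ τ₁ := (S.τ_pos 1).le
  -- the stage translated to the origin `τ₁`: unforced, classical, finite energy, bounded ⇒ Leray–Hopf
  set w : ℝ → EuclideanSpace ℝ (Fin 3) → EuclideanSpace ℝ (Fin 3) := fun σ => s.u (σ + τ₁) with hw
  have hwcl : IsClassicalNSSolutionOn (Icc 0 L) ν 0 w (fun σ => s.p (σ + τ₁)) :=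
    isClassicalNSSolutionOn_translate_of_silent s.classical hτ₁0 h1k hQ
  obtain ⟨C₁, hC₁, hE₁⟩ := s.energy
  have hEw : ∃ C : ℝ≥0∞, C < ⊤ ∧ ∀ σ ∈ Icc 0 L, ∫⁻ x, ‖w σ x‖ₑ ^ 2 ≤ C :=
    ⟨C₁, hC₁, fun σ hσ => hE₁ (σ + τ₁) ⟨by linarith [hσ.1], by rw [hL] at hσ; linarith [hσ.2]⟩⟩
  have hLH : IsLerayHopfOn L ν 0 (w 0) w := (isLerayHopfOn_of_finiteEnergy hwcl hν hL0 hEw).1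
  obtain ⟨W, hWg, hWw⟩ := exists_isGlobalLerayHopf_extension_Icc hν hL0 hLH
  have hWT : IsLerayHopfOn (L + 2) ν 0 (w 0) W := hWg (L + 2) (by linarith)
  -- the translated stage is a bounded classical representative of `W` on `[0, L)`
  have hV0 : IsClassicalNSSolutionOn (Ico 0 L) ν 0 w (fun σ => s.p (σ + τ₁)) :=
    hwcl.mono Ico_subset_Icc_self (uniqueDiffOn_Ico _ _)
  have hrep0 : ∀ σ ∈ Ico 0 L, W σ =ᵐ[volume] w σ := fun σ hσ => by
    rw [hWw σ (Ico_subset_Icc_self hσ)]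
  have hM0 : ∀ σ ∈ Ico 0 L, ∀ x, ‖w σ x‖ ≤ S.c₂ * R.Y k := fun σ hσ x =>
    s.ceiling k le_rfl (σ + τ₁) ⟨by linarith [hσ.1], by rw [hL] at hσ; linarith [hσ.2]⟩ x
  -- continuation of the representative strictly past `L`
  obtain ⟨b, hLb, V, P, hV, hV0w, hrepV, -⟩ :=
    exists_classical_extension_of_bounded_rep hν hWT hL0 (by linarith) hV0 hrep0 hM0
  -- `V` agrees with the translated stage on `[0, L)` (both continuous, a.e. equal to `W`)
  have hbT : L < min b (L + 2) := lt_min hLb (by linarith)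
  have hVs : ∀ σ ∈ Ico 0 (S.τ k - S.τ 1), V σ = s.u (σ + S.τ 1) := by
    intro σ hσ
    have hσ' : σ ∈ Ico 0 (min b (L + 2)) := ⟨hσ.1, hσ.2.trans hbT⟩
    have hae : V σ =ᵐ[volume] w σ := (hrepV σ hσ').symm.trans (hrep0 σ hσ)
    have hcV : Continuous (V σ) := (hV.contDiff_velocity ⟨hσ.1, hσ.2.trans hLb⟩).continuous
    have hcw : Continuous (w σ) := (hwcl.contDiff_velocity (Ico_subset_Icc_self hσ)).continuous
    exact (Continuous.ae_eq_iff_eq volume hcV hcw).1 hae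
  have hWs : ∀ σ ∈ Icc 0 (S.τ k - S.τ 1), W σ = s.u (σ + S.τ 1) := fun σ hσ => hWw σ hσ
  -- the end of the continuation: `T' = τ₁ + L'` with `L < L' < b`, `L' ≤ L + 2`
  set L' : ℝ := min (L + (b - L) / 2) (L + 1) with hL'
  have hLL' : L < L' := lt_min (by linarith) (by linarith)
  have hL'b : L' < b := (min_le_left _ _).trans_lt (by linarith)
  have hL'1 : L' ≤ L + 1 := min_le_right _ _
  have hrep : ∀ σ ∈ Icc 0 (τ₁ + L' - S.τ 1), W σ =ᵐ[volume] V σ := by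
    intro σ hσ
    have e : τ₁ + L' - S.τ 1 = L' := by rw [hτ₁]; ring
    rw [e] at hσ
    exact hrepV σ ⟨hσ.1, lt_min (hσ.2.trans_lt hL'b) (by linarith [hσ.2, hL'1])⟩
  obtain ⟨u, p, hcl, hagree, henergy, -⟩ :=
    s.exists_continuation_of_rep hν hQ hk hWT hWs hV hVs hrep
      (show S.τ k ≤ τ₁ + L' by rw [hL] at hLL'; linarith)
      (show τ₁ + L' - S.τ 1 < b by rw [hτ₁]; linarith)
      (show τ₁ + L' - S.τ 1 ≤ L + 2 by rw [hτ₁]; linarith [hL'1])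
  exact ⟨τ₁ + L', by rw [hL] at hLL'; linarith, u, p, hcl, hagree, henergy⟩

end Stage

/-- **At the generic levels `k ≥ 2` the local stub holds outright**: `LocalContinuationAt k` is a
THEOREM of the tree (`Stage.exists_local_continuation`) — the local-continuation stub of the upper
half is open only at `k ≤ 1`. [cite: RobinsonRodrigoSadowski2016, Thm. 8.17] -/
theorem localContinuationAt_of_two_le {k : ℕ} (hk : 2 ≤ k) : LocalContinuationAt k :=
  fun _ _ _ hQ s => s.exists_local_continuation one_pos hQ hk

/-- Hence at `k ≥ 2` the level-wise upper half is the a-priori ceiling ALONE (the level-wise form of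
ecbridge-5 g2's `continuationEnvelope_of_apriori` / `apriori_of_continuationEnvelope`).
[cite: RobinsonRodrigoSadowski2016, Thm. 8.17] -/
theorem continuationEnvelopeAt_iff_aprioriCeilingAt_of_two_le {k : ℕ} (hk : 2 ≤ k) :
    ContinuationEnvelopeAt k ↔ AprioriCeilingAt k :=
  ⟨fun h => h.aprioriCeilingAt,
    fun h => continuationEnvelopeAt_of_local_apriori (le_trans (by norm_num) hk)
      (localContinuationAt_of_two_le hk) h⟩


/-! ## The two stubs in VELOCITY form (any pressure gauge) -/

/-- **The local stub in velocity form**: it suffices that the continuation agree with the stage in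
VELOCITY on `[0, τ k]` — its pressure can be re-gauged by a smooth function of time to agree as well
(`IsClassicalNSSolutionOn.exists_pressure_eq_on_Icc`, Doering–Gibbon 1995 §1.2: the pressure is
determined by the velocity up to a function of time). This is the shape a local-existence theorem
from the slice `u(τ k)` delivers. [cite: DoeringGibbon1995, §1.2 eqs (1.2.17)–(1.2.21) (pp. 10–11)] -/
theorem localContinuationAt_iff_velocity {k : ℕ} :
    LocalContinuationAt k ↔
      ∀ S : Schedule TowerRates.wide, S.Pins 8 (6 / 5) → S.Rigid → S.Quiet →
        ∀ s : Stage 1 TowerRates.wide S (Margins.routeG TowerRates.wide) k,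
          ∃ T' : ℝ, S.τ k < T' ∧
            ∃ (u : ℝ → EuclideanSpace ℝ (Fin 3) → EuclideanSpace ℝ (Fin 3))
              (p : ℝ → EuclideanSpace ℝ (Fin 3) → ℝ),
              IsClassicalNSSolutionOn (Icc 0 T') 1 S.f u p ∧
              (∀ t ∈ Icc 0 (S.τ k), u t = s.u t) ∧
              (∃ C : ℝ≥0∞, C < ⊤ ∧ ∀ t ∈ Icc 0 T', ∫⁻ x, ‖u t x‖ₑ ^ 2 ≤ C) := by
  constructor
  · intro h S hP hR hQ s
    obtain ⟨T', hT', u, p, hcl, hagree, hE⟩ := h S hP hR hQ s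
    exact ⟨T', hT', u, p, hcl, fun t ht => (hagree t ht).1, hE⟩
  · intro h S hP hR hQ s
    obtain ⟨T', hT', u, p, hcl, hvel, hE⟩ := h S hP hR hQ s
    obtain ⟨P', hcl', hP'⟩ := s.classical.exists_pressure_eq_on_Icc hcl (S.τ_pos k) hT'.le hvel
    exact ⟨T', hT', u, P', hcl', fun t ht => ⟨hvel t ht, hP' t ht⟩, hE⟩

/-- **The a-priori ceiling in velocity form**: bounding the finite-energy classical continuations
that agree with the stage in VELOCITY only (any pressure gauge) is the same as bounding those that
agree in velocity and pressure — re-gauge the pressure (`exists_pressure_eq_on_Icc`); the velocity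
is untouched. [cite: DoeringGibbon1995, §1.2 eqs (1.2.17)–(1.2.21) (pp. 10–11)] -/
theorem aprioriCeilingAt_iff_velocity {k : ℕ} :
    AprioriCeilingAt k ↔
      ∀ S : Schedule TowerRates.wide, S.Pins 8 (6 / 5) → S.Rigid → S.Quiet →
        ∀ s : Stage 1 TowerRates.wide S (Margins.routeG TowerRates.wide) k,
        ∀ T' ∈ Icc (S.τ k) (S.τ (k + 1)),
        ∀ (u : ℝ → EuclideanSpace ℝ (Fin 3) → EuclideanSpace ℝ (Fin 3))
          (p : ℝ → EuclideanSpace ℝ (Fin 3) → ℝ),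
          IsClassicalNSSolutionOn (Icc 0 T') 1 S.f u p →
          (∀ t ∈ Icc 0 (S.τ k), u t = s.u t) →
          (∃ C : ℝ≥0∞, C < ⊤ ∧ ∀ t ∈ Icc 0 T', ∫⁻ x, ‖u t x‖ₑ ^ 2 ≤ C) →
          ∀ t ∈ Icc 0 T', ∀ x, ‖u t x‖ ≤ S.c₂ * TowerRates.wide.Y (k + 1) := by
  constructor
  · intro h S hP hR hQ s T' hT' u p hcl hvel hE
    obtain ⟨P', hcl', hP'⟩ := s.classical.exists_pressure_eq_on_Icc hcl (S.τ_pos k) hT'.1 hvel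
    exact h S hP hR hQ s T' hT' u P' hcl' (fun t ht => ⟨hvel t ht, hP' t ht⟩) hE
  · intro h S hP hR hQ s T' hT' u p hcl hagree hE
    exact h S hP hR hQ s T' hT' u p hcl (fun t ht => (hagree t ht).1) hE


/-! ## The level-wise halves in the fc-oneshot line's vocabulary (`Runs` / `Letter`, p. fc-prover-3) -/

/-- **The upper half at level `k` IS «every registered stage has a continuation that RUNS»** (line
`fc-oneshot` vocabulary `Runs`, `PalasekTowerRescaledCopy.lean`; definitional). [folklore] -/
theorem continuationEnvelopeAt_iff_runs {k : ℕ} :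
    ContinuationEnvelopeAt k ↔
      ∀ S : Schedule TowerRates.wide, S.Pins 8 (6 / 5) → S.Rigid → S.Quiet →
        ∀ s : Stage 1 TowerRates.wide S (Margins.routeG TowerRates.wide) k,
          ∃ (u : ℝ → EuclideanSpace ℝ (Fin 3) → EuclideanSpace ℝ (Fin 3))
            (p : ℝ → EuclideanSpace ℝ (Fin 3) → ℝ), Runs S k s u p :=
  Iff.rfl

/-- **The lower half at level `k` IS «every continuation that RUNS carries the next LETTER at
`τ (k+1)`»** (line `fc-oneshot` vocabulary `Runs` / `Letter`; currying only). So at `k = 1` the line's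
`FirstGate` (= `HeredityAtOne`, `Stage.exists_extends_iff_runs_letter`) splits into
`∀ s, ∃ u p, Runs S 1 s u p` and `∀ s u p, Runs S 1 s u p → Letter S 2 (u (τ 2))` — the two halves of
p422702, lossless. [folklore] -/
theorem readoutFloorsAt_iff_runs_letter {k : ℕ} :
    ReadoutFloorsAt k ↔
      ∀ S : Schedule TowerRates.wide, S.Pins 8 (6 / 5) → S.Rigid → S.Quiet →
        ∀ s : Stage 1 TowerRates.wide S (Margins.routeG TowerRates.wide) k,
        ∀ (u : ℝ → EuclideanSpace ℝ (Fin 3) → EuclideanSpace ℝ (Fin 3))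
          (p : ℝ → EuclideanSpace ℝ (Fin 3) → ℝ),
          Runs S k s u p → Letter S (k + 1) (u (S.τ (k + 1))) :=
  ⟨fun h S hP hR hQ s u p hr => h S hP hR hQ s u p hr.1 hr.2.1 hr.2.2.1 hr.2.2.2,
    fun h S hP hR hQ s u p h₁ h₂ h₃ h₄ => h S hP hR hQ s u p ⟨h₁, h₂, h₃, h₄⟩⟩

/-- **The first gate in halves, fc-oneshot vocabulary, no hypothesis**: `HeredityAtOne` iff every
registered level-1 stage has a continuation that `Runs`, and every continuation that `Runs` carries
the level-2 `Letter` at `τ 2`. [cite: Sohr2001, Ch. V Thm. 1.5.1] -/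
theorem heredityAtOne_iff_runs_and_letter :
    HeredityAtOne ↔
      (∀ S : Schedule TowerRates.wide, S.Pins 8 (6 / 5) → S.Rigid → S.Quiet →
        ∀ s : Stage 1 TowerRates.wide S (Margins.routeG TowerRates.wide) 1,
          ∃ (u : ℝ → EuclideanSpace ℝ (Fin 3) → EuclideanSpace ℝ (Fin 3))
            (p : ℝ → EuclideanSpace ℝ (Fin 3) → ℝ), Runs S 1 s u p) ∧
      (∀ S : Schedule TowerRates.wide, S.Pins 8 (6 / 5) → S.Rigid → S.Quiet →
        ∀ s : Stage 1 TowerRates.wide S (Margins.routeG TowerRates.wide) 1,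
        ∀ (u : ℝ → EuclideanSpace ℝ (Fin 3) → EuclideanSpace ℝ (Fin 3))
          (p : ℝ → EuclideanSpace ℝ (Fin 3) → ℝ),
          Runs S 1 s u p → Letter S (1 + 1) (u (S.τ (1 + 1)))) := by
  rw [heredityAtOne_iff_envelopeAt_and_floorsAt, continuationEnvelopeAt_iff_runs,
    readoutFloorsAt_iff_runs_letter]

end Summit.NavierStokesRegularity.FluidComputer.PalasekTowerClayBridge

end
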